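import Literature.Analysis.FluidPDE.LerayHeatTest
import Literature.Analysis.FluidPDE.LerayHopfMildH1
import Literature.Analysis.FluidPDE.TaoFiniteEnergyLerayHopf
import Literature.Analysis.FluidPDE.NSVorticityEnergy
import HarnessLib

/-!
# Tao (2011/2013), proof of Prop. 9.1: the pointwise Fourier majorant of the nonlinear Duhamel
# component of a finite energy classical solution

Third file (after `TaoFourierSchur.lean`, `LerayHeatTest.lean`, `TaoDuhamelSpeedMajorant.lean`) of
the discharge of the named fact `Literature.Analysis.FluidPDE.tao2011_duhamelNonlinearSpeed_unit`
(`TaoBoundedTotalSpeed.lean`; Tao 2011, arXiv:1108.1165, Prop. 9.1 = arXiv Prop. 52, proof,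
pp. 27–28). Tao starts from the Duhamel formula (9.2),
`u(t) = e^{tΔ}u₀ + ∫₀ᵗ e^{(t−t')Δ}(P O(∇(uu)))(t') dt'` (via Cor. 4.3 / Lemma 4.1 (i)), and bounds the
`L^∞_x` norm of the nonlinear component through the frequency-localised heat decay
`‖P_N e^{(t−t')Δ} P∇‖ ≲ N e^{-c(t-t')N²}`. Here the Duhamel formula of the finite energy classical
solution is used in its *tested* form — the duality identity of the tree for Leray–Hopf solutions
against `H¹_σ` fields (`IsLerayHopfOn.integral_inner_eq_mild_of_hasWeakGradient`; the solution is
Leray–Hopf by `isLerayHopfOn_of_finiteEnergy`, i.e. Lemma 8.1 + Lemma 4.1 (i), both proved) —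
with the Leray-projected heat kernel `φ = P(G_ε(· − x₀) e)` of `LerayHeatTest.lean` as test field:

* `∫⟪u(t), φ⟫ = ⟪(e^{εΔ}u(t))(x₀), e⟫` and `∫⟪u₀, e^{tΔ}φ⟫ = ⟪(e^{(ε+t)Δ}u₀)(x₀), e⟫`
  (`integral_inner_lerayHeatTest`, `heatExtension_lerayHeatTest`);
* the nonlinear term is `∑ⱼₖ ∫ uⱼuₖ (D P(G_{ε+t−τ} e)(x) eₖ)ⱼ` in coordinates
  (`integral_inner_convect_eq_sum_sum`), each entry bounded by the pairing bound
  `enorm_integral_mul_fderiv_lerayHeatTest_le` — on the Fourier side the symbol of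
  `∂ₖ e^{sΔ} P` is bounded by `2π‖ξ‖e^{-4π²s‖ξ‖²}`, Tao's "bounding the first order operator `P∇` by
  `N` on the range of `P_N`" and (energy-decay) — uniformly in `ε`
  (`enorm_integral_inner_convect_lerayHeatTest_le`);
* `ε → 0⁺` (`tendsto_heatExtension_nhdsGT_zero_of_continuousAt`, `continuousOn_heatExtension_time`).

Result (`enorm_sub_heatExtension_le_speedMajorant`): for a finite energy classical solution of the
unit-viscosity unforced system on `[0, T] × ℝ³`, every `t ∈ (0, T]` and every `x₀`,

  `‖u(t,x₀) − (e^{tΔ}u(0))(x₀)‖ ≤ 2π M(t)`,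
  `M(t) = ∫_{0<τ<t} ∑ⱼₖ ∫ ‖ξ‖ e^{-4π²(t-τ)‖ξ‖²} |𝓕(uⱼuₖ)(τ,ξ)| dξ dτ`,

whose time integral is bounded by `(6S/(2π)⁴)∫₀ᵀ∫|∇u|²_F` in `TaoDuhamelSpeedMajorant.lean`.
Everything here is proved; no definition is introduced.

## Mathlib / tree search

Tree (all proved): `isLerayHopfOn_of_finiteEnergy` (`TaoFiniteEnergyLerayHopf`),
`IsLerayHopfOn.integral_inner_eq_mild_of_hasWeakGradient` (`LerayHopfMildH1`),
`IsLerayHopfOn.isWeaklyDivFree_slice` (`LerayHopfMild`), `IsLerayHopfOn.isWeaklyDivFree_datum`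
(`LerayHopfProofs`), `lerayHeatTest` with `memLp_two_/isWeaklyDivFree_/hasWeakGradient_lerayHeatTest`,
`lintegral_frobeniusNormSq_fderiv_lerayHeatTest_lt_top`, `heatExtension_lerayHeatTest`,
`integral_inner_lerayHeatTest`, `enorm_integral_mul_fderiv_lerayHeatTest_le`, `inner_eq_sum_mul`
(`LerayHeatTest`), `convect_apply_comp`, `euclidean_fderiv_apply_comp` (`NSVorticityEnergy`,
`CoordDerivatives`), `heatTest_of_pos` (`MildSolution`), `tendsto_heatExtension_nhdsGT_zero_of_continuousAt`,
`continuousOn_heatExtension_time` (`HeatFlowCalculus`). Mathlib: `enorm_integral_le_lintegral_enorm`,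
`enorm_sum_le`, `Ioo_ae_eq_Ioc`, `le_of_tendsto`. No prior pointwise form of the nonlinear Duhamel
bound (`lean search 'sub_heatExtension_le|speedMajorant'`).

## References

* T. Tao, *Localisation and compactness properties of the Navier–Stokes global regularity
  problem*, Anal. PDE 6 (2013) 25–107 = arXiv:1108.1165 (`Tao2011`), §9, proof of Prop. 9.1
  (arXiv Prop. 52), pp. 27–28: (9.1)–(9.2) (projected equation, Duhamel formula), the display
  before (9.7) ("Using (energy-decay), and bounding the first order operator `P∇` by `N`").
* E. B. Fabes, B. F. Jones, N. M. Rivière, Arch. Rational Mech. Anal. 45 (1972), Thm. 2.1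
  (`FabesJonesRiviere1972`): the duality form of the Duhamel formula.
-/

noncomputable section

open MeasureTheory Set Function Filter Metric Real
open scoped ENNReal NNReal FourierTransform RealInnerProductSpace ContDiff Topology

namespace Literature.Analysis.FluidPDE

open UnboundedOperators

/-! ## The nonlinear pairing in coordinates -/

section Coordinates

/-- **The convective pairing in coordinates**: for fields `a, w` and a differentiable `Φ` on `ℝ³`,
`⟪a(x), ((w·∇)Φ)(x)⟫ = ∑ⱼₖ aⱼ(x) wₖ(x) (DΦ(x) eₖ)ⱼ`. [folklore] -/
theorem inner_convect_eq_sum_sum {a w Φ : EuclideanSpace ℝ (Fin 3) → EuclideanSpace ℝ (Fin 3)}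
    {x : EuclideanSpace ℝ (Fin 3)} (hΦ : DifferentiableAt ℝ Φ x) :
    ⟪a x, convect w Φ x⟫ = ∑ j, ∑ k, (a x j * w x k) * fderiv ℝ Φ x (stdVec k) j := by
  rw [inner_eq_sum_mul]
  refine Finset.sum_congr rfl fun j _ => ?_
  rw [convect_apply_comp hΦ j, Finset.mul_sum]
  refine Finset.sum_congr rfl fun k _ => ?_
  rw [pderiv_apply, ← euclidean_fderiv_apply_comp hΦ]
  ring

/-- The entries `(D P(G_σ e)(x) v)ⱼ` of the derivative of the Leray-projected heat kernel are bounded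
(by the `L¹` norm of the derivative symbol). [folklore] -/
theorem abs_fderiv_lerayHeatTest_apply_le {x₀ e : EuclideanSpace ℝ (Fin 3)} {σ : ℝ} (hσ : 0 < σ)
    (x v : EuclideanSpace ℝ (Fin 3)) (j : Fin 3) :
    |fderiv ℝ (lerayHeatTest x₀ σ e) x v j| ≤ ∫ ξ, ‖lerayHeatDerivSymbol x₀ σ e v j ξ‖ := by
  rw [fderiv_lerayHeatTest_apply hσ]
  exact (Complex.abs_re_le_norm _).trans (norm_fourier_le_integral_norm _ x)

/-- **The nonlinear pairing against the Leray-projected heat kernel in coordinates**: for an `L²`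
field `a` on `ℝ³` and `0 < σ`,
`∫ ⟪a, (a·∇) P(G_σ(·−x₀)e)⟫ = ∑ⱼₖ ∫ aⱼaₖ (D P(G_σ(·−x₀)e)(x) eₖ)ⱼ dx` (each product `aⱼaₖ` is
integrable and each derivative entry bounded). [folklore] -/
theorem integral_inner_convect_lerayHeatTest_eq_sum_sum {x₀ e : EuclideanSpace ℝ (Fin 3)} {σ : ℝ}
    (hσ : 0 < σ) {a : EuclideanSpace ℝ (Fin 3) → EuclideanSpace ℝ (Fin 3)} (ha : MemLp a 2 volume) :
    ∫ x, ⟪a x, convect a (lerayHeatTest x₀ σ e) x⟫ =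
      ∑ j, ∑ k, ∫ x, (a x j * a x k) * fderiv ℝ (lerayHeatTest x₀ σ e) x (stdVec k) j := by
  have hd : Differentiable ℝ (lerayHeatTest x₀ σ e) :=
    (contDiff_lerayHeatTest hσ).differentiable (by simp)
  have hint : ∀ j k, Integrable fun x =>
      (a x j * a x k) * fderiv ℝ (lerayHeatTest x₀ σ e) x (stdVec k) j := by
    intro j k
    have hajk : Integrable fun x => a x j * a x k :=
      ((EuclideanSpace.proj j : EuclideanSpace ℝ (Fin 3) →L[ℝ] ℝ).comp_memLp' ha).integrable_mul
        ((EuclideanSpace.proj k : EuclideanSpace ℝ (Fin 3) →L[ℝ] ℝ).comp_memLp' ha)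
    refine hajk.mul_bdd (c := ∫ ξ, ‖lerayHeatDerivSymbol x₀ σ e (stdVec k) j ξ‖) ?_
      (Eventually.of_forall fun x => ?_)
    · have hc : Continuous fun x => fderiv ℝ (lerayHeatTest x₀ σ e) x (stdVec k) :=
        ((contDiff_lerayHeatTest hσ).continuous_fderiv (by simp)).clm_apply continuous_const
      exact ((continuous_apply j).comp ((PiLp.continuous_ofLp 2 _).comp hc)).aestronglyMeasurable
    · rw [Real.norm_eq_abs]
      exact abs_fderiv_lerayHeatTest_apply_le hσ x (stdVec k) j
  calc ∫ x, ⟪a x, convect a (lerayHeatTest x₀ σ e) x⟫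
      = ∫ x, ∑ j, ∑ k, (a x j * a x k) * fderiv ℝ (lerayHeatTest x₀ σ e) x (stdVec k) j :=
        integral_congr_ae (Eventually.of_forall fun x => inner_convect_eq_sum_sum (hd x))
    _ = ∑ j, ∫ x, ∑ k, (a x j * a x k) * fderiv ℝ (lerayHeatTest x₀ σ e) x (stdVec k) j :=
        integral_finsetSum _ fun j _ => integrable_finsetSum _ fun k _ => hint j k
    _ = ∑ j, ∑ k, ∫ x, (a x j * a x k) * fderiv ℝ (lerayHeatTest x₀ σ e) x (stdVec k) j :=
        Finset.sum_congr rfl fun j _ => integral_finsetSum _ fun k _ => hint j k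

/-- **The nonlinear pairing is dominated by the Fourier majorant, uniformly in the regularisation**
(Tao 2011, proof of Prop. 9.1, display before (9.7): the symbol of `∂ₖ e^{sΔ}P` is bounded by
`2π‖ξ‖e^{-4π²s‖ξ‖²}`): for an `L²` field `a` on `ℝ³`, `0 ≤ ε` and `0 < s`,
`‖∫⟪a, (a·∇)P(G_{ε+s}(·−x₀)e)⟫‖ ≤ 2π‖e‖ ∑ⱼₖ ∫ ‖ξ‖ e^{-4π²s‖ξ‖²} |𝓕(aⱼaₖ)(ξ)| dξ`. [cite: Tao2011, Prop. 9.1 (proof, display before (9.7))] -/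
theorem enorm_integral_inner_convect_lerayHeatTest_le {x₀ e : EuclideanSpace ℝ (Fin 3)} {ε s : ℝ}
    (hε : 0 ≤ ε) (hs : 0 < s) {a : EuclideanSpace ℝ (Fin 3) → EuclideanSpace ℝ (Fin 3)}
    (ha : MemLp a 2 volume) :
    ‖∫ x, ⟪a x, convect a (lerayHeatTest x₀ (ε + s) e) x⟫‖ₑ ≤
      ENNReal.ofReal (2 * π * ‖e‖) * ∑ j, ∑ k,
        ∫⁻ ξ, ‖ξ‖ₑ * ENNReal.ofReal (heatSymbol s ξ) *
          ‖𝓕 (fun x => ((a x j * a x k : ℝ) : ℂ)) ξ‖ₑ := by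
  have hσ : 0 < ε + s := by positivity
  have hajk : ∀ j k, Integrable fun x => a x j * a x k := fun j k =>
    ((EuclideanSpace.proj j : EuclideanSpace ℝ (Fin 3) →L[ℝ] ℝ).comp_memLp' ha).integrable_mul
      ((EuclideanSpace.proj k : EuclideanSpace ℝ (Fin 3) →L[ℝ] ℝ).comp_memLp' ha)
  have hstd : ∀ k : Fin 3, ‖(stdVec k : EuclideanSpace ℝ (Fin 3))‖ = 1 := fun k => by
    simp [stdVec]
  -- heat symbol monotone in time
  have hmono : ∀ ξ : EuclideanSpace ℝ (Fin 3), heatSymbol (ε + s) ξ ≤ heatSymbol s ξ := by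
    intro ξ
    simp only [heatSymbol]
    refine Real.exp_le_exp.2 ?_
    have : 0 ≤ (2 * π) ^ 2 * ε * ‖ξ‖ ^ 2 := by positivity
    nlinarith
  have hterm : ∀ j k, ‖∫ x, (a x j * a x k) * fderiv ℝ (lerayHeatTest x₀ (ε + s) e) x (stdVec k) j‖ₑ ≤
      ENNReal.ofReal (2 * π * ‖e‖) *
        ∫⁻ ξ, ‖ξ‖ₑ * ENNReal.ofReal (heatSymbol s ξ) * ‖𝓕 (fun x => ((a x j * a x k : ℝ) : ℂ)) ξ‖ₑ := by
    intro j k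
    refine (enorm_integral_mul_fderiv_lerayHeatTest_le hσ (hajk j k) (stdVec k) j).trans ?_
    rw [hstd, mul_one]
    refine mul_le_mul' le_rfl (lintegral_mono fun ξ => ?_)
    gcongr
    exact hmono ξ
  rw [integral_inner_convect_lerayHeatTest_eq_sum_sum hσ ha]
  calc ‖∑ j, ∑ k, ∫ x, (a x j * a x k) * fderiv ℝ (lerayHeatTest x₀ (ε + s) e) x (stdVec k) j‖ₑ
      ≤ ∑ j, ‖∑ k, ∫ x, (a x j * a x k) * fderiv ℝ (lerayHeatTest x₀ (ε + s) e) x (stdVec k) j‖ₑ :=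
        enorm_sum_le _ _
    _ ≤ ∑ j, ∑ k, ‖∫ x, (a x j * a x k) * fderiv ℝ (lerayHeatTest x₀ (ε + s) e) x (stdVec k) j‖ₑ :=
        Finset.sum_le_sum fun j _ => enorm_sum_le _ _
    _ ≤ ∑ j, ∑ k, ENNReal.ofReal (2 * π * ‖e‖) *
          ∫⁻ ξ, ‖ξ‖ₑ * ENNReal.ofReal (heatSymbol s ξ) * ‖𝓕 (fun x => ((a x j * a x k : ℝ) : ℂ)) ξ‖ₑ :=
        Finset.sum_le_sum fun j _ => Finset.sum_le_sum fun k _ => hterm j k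
    _ = ENNReal.ofReal (2 * π * ‖e‖) * ∑ j, ∑ k,
          ∫⁻ ξ, ‖ξ‖ₑ * ENNReal.ofReal (heatSymbol s ξ) * ‖𝓕 (fun x => ((a x j * a x k : ℝ) : ℂ)) ξ‖ₑ := by
        rw [Finset.mul_sum]
        refine Finset.sum_congr rfl fun j _ => ?_
        rw [Finset.mul_sum]

end Coordinates

/-! ## The tested Duhamel formula against the Leray-projected heat kernel -/

section Tested

variable {T : ℝ} {u : ℝ → EuclideanSpace ℝ (Fin 3) → EuclideanSpace ℝ (Fin 3)}
  {p : ℝ → EuclideanSpace ℝ (Fin 3) → ℝ}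

/-- **The regularised nonlinear Duhamel component against a direction, bounded by the majorant.**
For a finite energy classical solution of the unit-viscosity unforced system on `[0, T] × ℝ³`,
`t ∈ (0, T]`, `x₀`, `e` and `0 < ε`:
`|⟪(e^{εΔ}u(t))(x₀), e⟫ − ⟪(e^{(ε+t)Δ}u(0))(x₀), e⟫| ≤ 2π‖e‖ M(t)` in `ℝ≥0∞`, with the Fourier
majorant `M(t) = ∫_{0<τ<t} ∑ⱼₖ ∫ ‖ξ‖ e^{-4π²(t-τ)‖ξ‖²} |𝓕(uⱼuₖ)(τ,ξ)| dξ dτ` — the duality identity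
(tested Duhamel formula (9.2)) with `φ = P(G_ε(·−x₀)e)`. [cite: Tao2011, Prop. 9.1 (proof, (9.2) and display before (9.7))] -/
theorem enorm_inner_heatExtension_sub_le_speedMajorant (hT : 0 < T)
    (hsol : IsClassicalNSSolutionOn (Icc 0 T) 1 0 u p)
    (hfe : ∃ A : ℝ≥0∞, A < ⊤ ∧ ∀ t ∈ Icc 0 T, ∫⁻ x, ‖u t x‖ₑ ^ 2 ≤ A)
    {t : ℝ} (ht : t ∈ Ioc 0 T) (x₀ e : EuclideanSpace ℝ (Fin 3)) {ε : ℝ} (hε : 0 < ε) :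
    ‖⟪heatExtension (u t) ε x₀, e⟫ - ⟪heatExtension (u 0) (ε + t) x₀, e⟫‖ₑ ≤
      ENNReal.ofReal (2 * π * ‖e‖) * ∫⁻ τ in Ioo 0 t, ∑ j, ∑ k,
        ∫⁻ ξ, ‖ξ‖ₑ * ENNReal.ofReal (heatSymbol (t - τ) ξ) *
          ‖𝓕 (fun x => ((u τ x j * u τ x k : ℝ) : ℂ)) ξ‖ₑ := by
  obtain ⟨hLH, -⟩ := isLerayHopfOn_of_finiteEnergy hsol one_pos hT hfe
  have hL2 : ∀ s ∈ Icc 0 T, MemLp (u s) 2 volume := hLH.memLp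
  have h0T : (0 : ℝ) ∈ Icc 0 T := ⟨le_rfl, hT.le⟩
  have htT : t ∈ Icc 0 T := ⟨ht.1.le, ht.2⟩
  have hdivt : IsWeaklyDivFree (u t) := hLH.isWeaklyDivFree_slice ht
  have hdiv0 : IsWeaklyDivFree (u 0) := hLH.isWeaklyDivFree_datum hT
  -- the duality identity with `φ = P(G_ε(· - x₀) e)`
  have hid := hLH.integral_inner_eq_mild_of_hasWeakGradient finrank_euclideanSpace_fin (hL2 0 h0T)
    one_pos hT (memLp_two_lerayHeatTest (x₀ := x₀) (e := e) hε)
    (isWeaklyDivFree_lerayHeatTest hε) (hasWeakGradient_lerayHeatTest hε)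
    (lintegral_frobeniusNormSq_fderiv_lerayHeatTest_lt_top hε) ht
  -- the two linear terms
  have hlhs : ∫ x, ⟪u t x, lerayHeatTest x₀ ε e x⟫ = ⟪heatExtension (u t) ε x₀, e⟫ :=
    integral_inner_lerayHeatTest hε (hL2 t htT) hdivt
  have hfree : ∫ x, ⟪u 0 x, heatTest 1 (lerayHeatTest x₀ ε e) t x⟫ =
      ⟪heatExtension (u 0) (ε + t) x₀, e⟫ := by
    have hfun : heatTest 1 (lerayHeatTest x₀ ε e) t = lerayHeatTest x₀ (ε + t) e := by
      rw [heatTest_of_pos one_pos ht.1, one_mul]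
      funext x
      exact heatExtension_lerayHeatTest hε ht.1 x
    rw [hfun]
    exact integral_inner_lerayHeatTest (add_pos hε ht.1) (hL2 0 h0T) hdiv0
  -- the nonlinear term, pointwise in `τ ∈ (0, t)`
  set c : ℝ → ℝ := fun τ => ∫ x, ⟪u τ x, convect (u τ) (heatTest 1 (lerayHeatTest x₀ ε e) (t - τ)) x⟫
    with hc
  have hcτ : ∀ τ ∈ Ioo 0 t, ‖c τ‖ₑ ≤ ENNReal.ofReal (2 * π * ‖e‖) * ∑ j, ∑ k,
      ∫⁻ ξ, ‖ξ‖ₑ * ENNReal.ofReal (heatSymbol (t - τ) ξ) *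
        ‖𝓕 (fun x => ((u τ x j * u τ x k : ℝ) : ℂ)) ξ‖ₑ := by
    intro τ hτ
    have hs : 0 < t - τ := sub_pos.2 hτ.2
    have hfun : heatTest 1 (lerayHeatTest x₀ ε e) (t - τ) = lerayHeatTest x₀ (ε + (t - τ)) e := by
      rw [heatTest_of_pos one_pos hs, one_mul]
      funext x
      exact heatExtension_lerayHeatTest hε hs x
    simp only [hc, hfun]
    exact enorm_integral_inner_convect_lerayHeatTest_le hε.le hs
      (hL2 τ ⟨hτ.1.le, (hτ.2.trans_le ht.2).le⟩)
  -- the nonlinear term, integrated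
  have hNL : ‖∫ τ in Ioc 0 t, c τ‖ₑ ≤ ENNReal.ofReal (2 * π * ‖e‖) * ∫⁻ τ in Ioo 0 t, ∑ j, ∑ k,
      ∫⁻ ξ, ‖ξ‖ₑ * ENNReal.ofReal (heatSymbol (t - τ) ξ) *
        ‖𝓕 (fun x => ((u τ x j * u τ x k : ℝ) : ℂ)) ξ‖ₑ := by
    calc ‖∫ τ in Ioc 0 t, c τ‖ₑ ≤ ∫⁻ τ in Ioc 0 t, ‖c τ‖ₑ := enorm_integral_le_lintegral_enorm _
      _ = ∫⁻ τ in Ioo 0 t, ‖c τ‖ₑ := setLIntegral_congr Ioo_ae_eq_Ioc.symm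
      _ ≤ ∫⁻ τ in Ioo 0 t, ENNReal.ofReal (2 * π * ‖e‖) * ∑ j, ∑ k,
            ∫⁻ ξ, ‖ξ‖ₑ * ENNReal.ofReal (heatSymbol (t - τ) ξ) *
              ‖𝓕 (fun x => ((u τ x j * u τ x k : ℝ) : ℂ)) ξ‖ₑ := setLIntegral_mono' measurableSet_Ioo hcτ
      _ = _ := lintegral_const_mul' _ _ ENNReal.ofReal_ne_top
  -- assemble
  have hkey : ⟪heatExtension (u t) ε x₀, e⟫ - ⟪heatExtension (u 0) (ε + t) x₀, e⟫ =
      ∫ τ in Ioc 0 t, c τ := by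
    rw [← hlhs, ← hfree, hid]
    ring
  rw [hkey]
  exact hNL

/-- **The nonlinear Duhamel component is dominated pointwise by the Fourier majorant** (Tao
2011, proof of Prop. 9.1: (9.2) and the frequency-side bounds before (9.7)). For a finite energy
classical solution `(u, p)` of the unit-viscosity unforced Navier–Stokes system on the closed slab
`[0, T] × ℝ³` (finite energy: `sup_t ∫|u(t)|² < ∞`), every `t ∈ (0, T]` and every `x₀ ∈ ℝ³`,

  `‖u(t, x₀) − (e^{tΔ}u(0))(x₀)‖ ≤ 2π ∫_{0<τ<t} ∑ⱼₖ ∫ ‖ξ‖ e^{-4π²(t-τ)‖ξ‖²} |𝓕(uⱼuₖ)(τ,ξ)| dξ dτ`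

in `ℝ≥0∞` (`e^{tΔ} = heatExtension`, the Gauss–Weierstrass integral; components and products in
the standard coordinates of `ℝ³`). Proof: the regularised bound
`enorm_inner_heatExtension_sub_le_speedMajorant` and `ε → 0⁺`. [cite: Tao2011, Prop. 9.1 (proof, (9.2)–(9.7))] -/
theorem enorm_sub_heatExtension_le_speedMajorant (hT : 0 < T)
    (hsol : IsClassicalNSSolutionOn (Icc 0 T) 1 0 u p)
    (hfe : ∃ A : ℝ≥0∞, A < ⊤ ∧ ∀ t ∈ Icc 0 T, ∫⁻ x, ‖u t x‖ₑ ^ 2 ≤ A)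
    {t : ℝ} (ht : t ∈ Ioc 0 T) (x₀ : EuclideanSpace ℝ (Fin 3)) :
    ‖u t x₀ - heatExtension (u 0) t x₀‖ₑ ≤
      ENNReal.ofReal (2 * π) * ∫⁻ τ in Ioo 0 t, ∑ j, ∑ k,
        ∫⁻ ξ, ‖ξ‖ₑ * ENNReal.ofReal (heatSymbol (t - τ) ξ) *
          ‖𝓕 (fun x => ((u τ x j * u τ x k : ℝ) : ℂ)) ξ‖ₑ := by
  set M : ℝ≥0∞ := ∫⁻ τ in Ioo 0 t, ∑ j, ∑ k,
      ∫⁻ ξ, ‖ξ‖ₑ * ENNReal.ofReal (heatSymbol (t - τ) ξ) *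
        ‖𝓕 (fun x => ((u τ x j * u τ x k : ℝ) : ℂ)) ξ‖ₑ with hM
  rcases eq_or_lt_of_le (le_top : M ≤ ⊤) with hMtop | hMtop
  · rw [hMtop, ENNReal.mul_top (ENNReal.ofReal_pos.2 (by positivity)).ne']
    exact le_top
  obtain ⟨hLH, -⟩ := isLerayHopfOn_of_finiteEnergy hsol one_pos hT hfe
  have hL2 : ∀ s ∈ Icc 0 T, MemLp (u s) 2 volume := hLH.memLp
  have h0T : (0 : ℝ) ∈ Icc 0 T := ⟨le_rfl, hT.le⟩
  have htT : t ∈ Icc 0 T := ⟨ht.1.le, ht.2⟩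
  set w : EuclideanSpace ℝ (Fin 3) := u t x₀ - heatExtension (u 0) t x₀ with hw
  -- the regularised bound, in real form
  have hreg : ∀ e : EuclideanSpace ℝ (Fin 3), ∀ ε : ℝ, 0 < ε →
      |⟪heatExtension (u t) ε x₀, e⟫ - ⟪heatExtension (u 0) (ε + t) x₀, e⟫| ≤
        2 * π * ‖e‖ * M.toReal := by
    intro e ε hε
    have h := enorm_inner_heatExtension_sub_le_speedMajorant hT hsol hfe ht x₀ e hε
    rw [← hM] at h
    have h2 : ‖⟪heatExtension (u t) ε x₀, e⟫ - ⟪heatExtension (u 0) (ε + t) x₀, e⟫‖ₑ ≤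
        ENNReal.ofReal (2 * π * ‖e‖ * M.toReal) := by
      rwa [ENNReal.ofReal_mul (by positivity : 0 ≤ 2 * π * ‖e‖), ENNReal.ofReal_toReal hMtop.ne]
    rw [← ofReal_norm, ENNReal.ofReal_le_ofReal_iff (by positivity), Real.norm_eq_abs] at h2
    exact h2
  -- `ε → 0⁺`
  have hlim1 : Tendsto (fun ε : ℝ => heatExtension (u t) ε x₀) (𝓝[>] 0) (𝓝 (u t x₀)) :=
    tendsto_heatExtension_nhdsGT_zero_of_continuousAt (hL2 t htT) one_le_two
      (hsol.contDiff_velocity htT).continuous.continuousAt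
  have hlim2 : Tendsto (fun ε : ℝ => heatExtension (u 0) (ε + t) x₀) (𝓝[>] 0)
      (𝓝 (heatExtension (u 0) t x₀)) := by
    have hcont : ContinuousAt (fun σ : ℝ => heatExtension (u 0) σ x₀) t :=
      (continuousOn_heatExtension_time (hL2 0 h0T) one_le_two x₀).continuousAt (Ioi_mem_nhds ht.1)
    have hadd : Tendsto (fun ε : ℝ => ε + t) (𝓝[>] 0) (𝓝 t) := by
      have h : Tendsto (fun ε : ℝ => ε + t) (𝓝 0) (𝓝 (0 + t)) :=
        (continuous_id.add continuous_const).tendsto 0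
      rw [zero_add] at h
      exact h.mono_left nhdsWithin_le_nhds
    exact hcont.tendsto.comp hadd
  have hbound : ∀ e : EuclideanSpace ℝ (Fin 3), |⟪w, e⟫| ≤ 2 * π * ‖e‖ * M.toReal := by
    intro e
    have hT' : Tendsto (fun ε : ℝ => |⟪heatExtension (u t) ε x₀, e⟫ -
        ⟪heatExtension (u 0) (ε + t) x₀, e⟫|) (𝓝[>] 0) (𝓝 |⟪w, e⟫|) := by
      have h : Tendsto (fun ε : ℝ => |⟪heatExtension (u t) ε x₀, e⟫ -
          ⟪heatExtension (u 0) (ε + t) x₀, e⟫|) (𝓝[>] 0)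
          (𝓝 |⟪u t x₀, e⟫ - ⟪heatExtension (u 0) t x₀, e⟫|) :=
        ((hlim1.inner (𝕜 := ℝ) (tendsto_const_nhds (x := e))).sub
          (hlim2.inner (𝕜 := ℝ) (tendsto_const_nhds (x := e)))).abs
      rw [hw, inner_sub_left]
      exact h
    exact le_of_tendsto hT' (eventually_nhdsWithin_of_forall fun ε hε => hreg e ε hε)
  -- take `e = w`
  have hnorm : ‖w‖ ≤ 2 * π * M.toReal := by
    have h := hbound w
    rw [real_inner_self_eq_norm_sq, abs_of_nonneg (sq_nonneg _), sq] at h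
    rcases eq_or_lt_of_le (norm_nonneg w) with h0 | hpos
    · rw [← h0]; positivity
    · exact le_of_mul_le_mul_right (by linarith [h]) hpos
  calc ‖w‖ₑ = ENNReal.ofReal ‖w‖ := (ofReal_norm w).symm
    _ ≤ ENNReal.ofReal (2 * π * M.toReal) := ENNReal.ofReal_le_ofReal hnorm
    _ = ENNReal.ofReal (2 * π) * M := by
        rw [ENNReal.ofReal_mul (by positivity), ENNReal.ofReal_toReal hMtop.ne]

end Tested

end Literature.Analysis.FluidPDE

end
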